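import Summits.Schanuel.Schanuel.Theorems.RootDecomp1KLevelFinite08

/-!
# RootDecomp1KLevelFinite — lens 1, generation 51 ADDENDUM «BOTH SPLIT CONJUGATE-POLES LEAVES CLOSED: normShapeLF_holds» (§8 SplitGrades) — continuation (RootDecomp1KLevelFinite09): §8.7 assembly normShapeLF_holds + §8.8 corollaries + §8.9 hyp-free instances

(lens-1 g51 ADDENDUM kernel K″ = HOME/decomp-schanuel-lens-1/g51/LevelFiniteSplit.lean 375ea065…, 2255 l = node-10 K b1fbaeff… VERBATIM (843/843 lines in order; ported as RootDecomp1KLevelFinite01–04) + TWO pure insertions: an addendum module docstring and `§8 section SplitGrades` (K″ l.863–2252, 75 decls); same single import …RootDecomp1KXLinear05; P″ LevelFiniteSplitProbe.lean rc 0 / C₀″ rc 0 / C″ LevelFiniteSplitCtrl.lean rc 1 = 10 planted; ADDENDUM/NODE L2486 / REQUEST L2487, critic VERDICT L2488: CLEARED under RULE K-R40 (ii)/(v) — ONE THEOREM ×1 «CONJUGATE-POLES LEAVES CLOSED: (NormShapeLevels g q a D).Finite for EVERY NormShapeHyp g q a D, uniformly over all grades, by a two-pass 2-adic Ridout argument in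 PadicAlgCl 2 on the tree's `RootDecomp1KXLinearCore.ridout_step`»; writer re-check L2489; PORT GO. Port by census-1 gen 21 of §8 as `RootDecomp1KLevelFinite05–09` continuing the 01–04 chain: 05 = §8.0 norms of integers in `PadicAlgCl 2`, binary forms `hform`, + §8.1 Bezout identities (`cpoly`, `bezout_forms`); 06 = §8.2 resultant data of a conjugate-poles shape + §8.3 the monicised quadratic in 𝕂 (`two_roots`, `ghatc`); 07 = §8.4 one level: integer bookkeeping (`psNumer_le`, `hform_two_eq`, …) + §8.5 the 𝕂-side (`nearest_root`, root extraction, `lamq`); 08 = §8.6 one level: height, arithmetic and the 2-adic closeness (`heightC`, `level_arith`, `level_padic`); 09 = §8.7 assembly **`normShapeLF_holds`** + §8.8 corollaries `normShapeLFSplitImag_holds` / `normShapeLFSplitReal_holds` (the two K binders LITERALLY), `levelFinite_of_siegelShapes''` / `thinFibre_of_siegelShapes''` / `b_of_siegelShapes''` (⟸ `SiegelShapes` ALONE) + §8.9 hyp-free instances `normShapeCurve`, `levelFinite_normShapeCurve`, `levelFinite_sqrt17_curve` (g47's residual (δ) family member DECIDED). PORT EDITS (census convention, pre-sanctioned L2488):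 `psNumer_pos'` privatised (homonym statement of private tree `psNumer_pos`); `isCoprime_num_den` stays private (privatised in 03; private copies where §8 calls it); 24 one-line helper docstrings (statements quoted); `section SplitGrades` with its two `open … (…)` lines closed / re-opened per part, the `open … (bev_map_C)` of §8.9 travels inside 09; statements and proofs otherwise verbatim, no renames, no heartbeat lines. `--supports stmt-Schanuel-33364`; no census credit carried; rung 0 — nothing here proves Schanuel, 33364, 31077, 33363, SiegelShapes, or ThinFibre m₀ / (b) hypothesis-free.)
-/

noncomputable section

open Polynomial LiouvilleNumber
open scoped Nat

namespace Summit.Schanuel.Schanuel.Theorems.RootDecomp1KLevelFinite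

open Summit.Schanuel.Schanuel.Theorems.RootDecomp1KSkelCell (iota SkelLiouville SkelLiouvilleFix
  skelLiouville_iff_fix SkelLiouvilleFix.mono)
open Summit.Schanuel.Schanuel.Theorems.RootDecomp1KTwoBaseCell (psNumer partialSum_eq_psNumer_div coprime_psNumer
  sb_of_range_eq')
open Summit.Schanuel.Schanuel.Theorems.RootDecomp1KRelLiouvilleCell (partialSum_two_strictMono)
open Summit.Schanuel.Schanuel.Theorems.RootDecomp1KDegreeLadder
open Summit.Schanuel.Schanuel.Theorems.RootDecomp1KXLinear (xLinP bev_xLinP aeval_ratCast levels_finite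
  thinFibreAt_mul_left)
open Summit.Schanuel.Schanuel.Theorems.RootDecomp1KHyper (SB SFset sb_of_algebraicIndependent)

/-- Numerator and denominator of a rational are coprime integers. -/
private theorem isCoprime_num_den (t : ℚ) : IsCoprime t.num (t.den : ℤ) := by
  rw [Int.isCoprime_iff_gcd_eq_one, Int.gcd_eq_natAbs, Int.natAbs_natCast]
  exact t.reduced

/-- `{q : ℤ[X]} (hq : q.natDegree = 2) : q.coeff 2 ≠ 0`. -/
private theorem coeff_two_ne_zero_of_natDegree {q : ℤ[X]} (hq : q.natDegree = 2) : q.coeff 2 ≠ 0 := by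
  have hq0 : q ≠ 0 := by rintro rfl; simp at hq
  rw [← hq, coeff_natDegree]; exact leadingCoeff_ne_zero.mpr hq0

section SplitGrades

open Summit.Schanuel.Schanuel.Theorems.RootDecomp1KXLinearCore (roots_structure ridout_step)
open Summit.Schanuel.Schanuel.Theorems.RootDecomp1KXLinear (norm_psNumer_sub_one)

/-! ### §8.7 Assembly: EVERY conjugate-poles grade has finite level sets (Ridout in `\overline{ℚ₂}`) -/

/-- **Theorem (all conjugate-poles grades, split or not, uniformly).**  For a shape
`g(t) = D · s_N · q(t)^a` with `q` an irreducible integer quadratic, `g ⊥ q`, `deg g ≤ 2a`, `a ≥ 1`, `D ≠ 0`,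
the set of levels `N` carrying a rational point is FINITE.  Proof: §8.2–§8.6 + two applications of
`RootDecomp1KXLinearCore.ridout_step` (`p`-adic Ridout with `p = 2`, exponent `3/2`). -/
theorem normShapeLF_holds (g q : ℤ[X]) (a : ℕ) (D : ℤ) (hH : NormShapeHyp g q a D) :
    (NormShapeLevels g q a D).Finite := by
  classical
  obtain ⟨hq, hnr, hcop, ha, hga, hD⟩ := hH
  have hq2 : q.coeff 2 ≠ 0 := coeff_two_ne_zero_of_natDegree hq
  have hq2K : (q.coeff 2 : PadicAlgCl 2) ≠ 0 := by exact_mod_cast hq2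
  -- (R) resultant data
  obtain ⟨d, K, Cb, hd, hKa, hK2, hCb, hRes⟩ := resultant_data hq hnr hga hcop
  have hdiv : ∀ u v : ℤ, v ≠ 0 → IsCoprime u v →
      ∀ m : ℤ, m ∣ hform g.coeff (2 * a) u v → m ∣ hform q.coeff 2 u v → m ∣ d :=
    fun u v hv huv => (hRes u v hv).1 huv
  have hd1 : (1 : ℝ) ≤ |(d : ℝ)| := by rw [← Int.cast_abs]; exact_mod_cast Int.one_le_abs hd
  -- (E) thresholds
  obtain ⟨E₀, hE₀⟩ : ∃ E₀ : ℕ, |d| < 2 ^ E₀ := by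
    refine ⟨d.natAbs, ?_⟩
    have := Nat.lt_two_pow_self (n := d.natAbs)
    rw [Int.abs_eq_natAbs]; exact_mod_cast this
  obtain ⟨Cq, hCq⟩ : ∃ Cq : ℕ, ¬ (2 : ℤ) ^ Cq ∣ q.coeff 2 := by
    refine ⟨(q.coeff 2).natAbs, fun h => ?_⟩
    have h1 := Int.le_of_dvd (abs_pos.mpr hq2) ((dvd_abs _ _).mpr h)
    have h2 : |q.coeff 2| < 2 ^ (q.coeff 2).natAbs := by
      have := Nat.lt_two_pow_self (n := (q.coeff 2).natAbs); rw [Int.abs_eq_natAbs]; exact_mod_cast this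
    exact absurd h1 (not_le.mpr h2)
  obtain ⟨vD, D', hDdec, hD'odd, -⟩ := two_adic_decomp hD
  -- (Θ) the two roots of the monicised quadratic
  obtain ⟨θ₁, θ₂, hsum, hprod, hne, hθ₁1, hθ₂1, halg₁, halg₂, hr₁, hr₂⟩ := two_roots hq hnr
  set δ : ℝ := ‖θ₁ - θ₂‖ * (1 / 2 : ℝ) ^ Cq with hδ
  have hδpos : 0 < δ := by have := norm_pos_iff.mpr (sub_ne_zero.mpr hne); positivity
  have hĝ₁ := ghat_ne_zero (a := a) hq hga hcop hr₁
  have hĝ₂ := ghat_ne_zero (a := a) hq hga hcop hr₂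
  set γ : ℝ := min ‖hform (ghatc g q a) (2 * a) θ₁ 1‖ ‖hform (ghatc g q a) (2 * a) θ₂ 1‖ with hγ
  have hγpos : 0 < γ := lt_min (norm_pos_iff.mpr hĝ₁) (norm_pos_iff.mpr hĝ₂)
  have halgθs : ∀ ζ ∈ ({θ₁, θ₂} : Finset (PadicAlgCl 2)), IsAlgebraic ℚ ζ := by
    intro ζ hζ
    simp only [Finset.mem_insert, Finset.mem_singleton] at hζ
    rcases hζ with rfl | rfl
    exacts [halg₁, halg₂]
  -- (Λ) root data for the targets `λ(κ, θ) = q₂^{2a} κ / ĝ(θ)` (chosen for every pair, junk-safe)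
  have hΛ : ∀ p : ℤ × PadicAlgCl 2, ∃ (T : Finset (PadicAlgCl 2)) (C₁ : ℝ), 0 < C₁ ∧
      (∀ ζ ∈ T, IsAlgebraic ℚ ζ) ∧
      ((p.1 ≠ 0 ∧ (p.2 = θ₁ ∨ p.2 = θ₂)) → ∀ (x : PadicAlgCl 2) (η : ℝ),
        ‖x ^ (2 * a) - (q.coeff 2 : PadicAlgCl 2) ^ (2 * a) * p.1 / hform (ghatc g q a) (2 * a) p.2 1‖ ≤ η →
        ∃ ζ ∈ T, ‖x - ζ‖ ≤ C₁ * η) := by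
    rintro ⟨κ, θ⟩
    by_cases hp : κ ≠ 0 ∧ (θ = θ₁ ∨ θ = θ₂)
    · obtain ⟨hκ, hθ⟩ := hp
      have hθalg : IsAlgebraic ℚ θ := by rcases hθ with rfl | rfl; exacts [halg₁, halg₂]
      have hĝθ : hform (ghatc g q a) (2 * a) θ 1 ≠ 0 := by rcases hθ with rfl | rfl; exacts [hĝ₁, hĝ₂]
      have hlam0 : (q.coeff 2 : PadicAlgCl 2) ^ (2 * a) * κ / hform (ghatc g q a) (2 * a) θ 1 ≠ 0 :=
        div_ne_zero (mul_ne_zero (pow_ne_zero _ hq2K) (by exact_mod_cast hκ)) hĝθ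
      have hlamalg : IsAlgebraic ℚ ((q.coeff 2 : PadicAlgCl 2) ^ (2 * a) * κ / hform (ghatc g q a) (2 * a) θ 1) := by
        rw [isAlgebraic_iff_isIntegral, div_eq_mul_inv]
        refine IsIntegral.mul (((isIntegral_intCast_K _).pow _).mul (isIntegral_intCast_K _)) ?_
        exact (isIntegral_hform _ _ (isAlgebraic_iff_isIntegral.mp hθalg)).inv
      obtain ⟨T, C₁, hC₁, hTalg, hT⟩ := root_extract (2 * a) (by omega) _ hlam0 hlamalg
      exact ⟨T, C₁, hC₁, hTalg, fun _ => hT⟩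
    · exact ⟨∅, 1, one_pos, by simp, fun h => absurd h hp⟩
  choose T C₁ hC₁ hTalg hT using hΛ
  -- constants
  have hCh1 : 1 ≤ heightC q Cb K D := one_le_heightC q Cb K D
  set A₀ : ℝ := heightC q Cb K D * |(d : ℝ)| with hA₀
  have hA₀1 : 1 ≤ A₀ := one_le_mul_of_one_le_of_one_le hCh1 hd1
  set κB : ℤ := |D| * |d| ^ a * 2 ^ E₀ with hκB
  set N₁ : ℕ := max 2 (max (3 * E₀ + 8) (vD + a * (Cq + E₀))) with hN₁
  -- the finite candidate sets for `v = den t` and `Z = q₂ · num t`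
  set V : Set ℤ := ⋃ κ ∈ Set.Icc (-κB) κB, ⋃ θ ∈ ({θ₁, θ₂} : Set (PadicAlgCl 2)),
      {Z : ℤ | ∃ t : ℕ, |(Z : ℝ)| ≤ A₀ * 2 ^ t ∧ ∃ ζ ∈ T (κ, θ),
        ‖(Z : PadicAlgCl 2) - ((1 : ℤ) : PadicAlgCl 2) * ζ‖
          ≤ (C₁ (κ, θ) * ((2 / δ + 1) / γ)) * ((1 / 2 : ℝ) ^ t) ^ (3 / 2 : ℝ)} with hV
  have hVfin : V.Finite := by
    refine (Set.finite_Icc (-κB) κB).biUnion fun κ _ => ?_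
    refine (Set.toFinite ({θ₁, θ₂} : Set (PadicAlgCl 2))).biUnion fun θ _ => ?_
    exact ridout_step (T (κ, θ)) (hTalg (κ, θ)) 1 (ρ := 3 / 2) (by norm_num) (by positivity)
      (mul_pos (hC₁ (κ, θ)) (by positivity))
  set U : Set ℤ := ⋃ v₀ ∈ V, {Z : ℤ | ∃ t : ℕ, |(Z : ℝ)| ≤ (|(q.coeff 2 : ℝ)| * A₀) * 2 ^ t ∧
      ∃ ζ ∈ ({θ₁, θ₂} : Finset (PadicAlgCl 2)),
        ‖(Z : PadicAlgCl 2) - (v₀ : PadicAlgCl 2) * ζ‖ ≤ (2 / δ) * ((1 / 2 : ℝ) ^ t) ^ (3 / 2 : ℝ)} with hU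
  have hUfin : U.Finite := by
    refine hVfin.biUnion fun v₀ _ => ?_
    have hq2R : 0 < |(q.coeff 2 : ℝ)| := abs_pos.mpr (by exact_mod_cast hq2)
    exact ridout_step _ halgθs v₀ (ρ := 3 / 2) (by norm_num) (by positivity) (by positivity)
  set Tpts : Set ℚ := (fun p : ℤ × ℤ => ((p.2 : ℚ) / (q.coeff 2 : ℚ)) / (p.1 : ℚ)) '' (V ×ˢ U) with hTpts
  have hTfin : Tpts.Finite := (hVfin.prod hUfin).image _
  set F : Set ℚ := (fun t : ℚ => aeval t g / (D * (aeval t q) ^ a)) '' Tpts with hF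
  have hFfin : F.Finite := hTfin.image _
  -- MAIN: `levels ⊆ {N < N₁} ∪ {N | sQ N ∈ F}`
  refine ((Set.finite_lt_nat N₁).union (finite_levels_of_finite hFfin)).subset ?_
  rintro N ⟨t, ht⟩
  by_cases hN : N < N₁
  · exact Or.inl hN
  right
  have hN₁ : N₁ ≤ N := not_lt.mp hN
  have hN2 : 2 ≤ N := le_trans (le_max_left _ _) hN₁
  have hNE : 3 * E₀ + 8 ≤ N := le_trans (le_trans (le_max_left _ _) (le_max_right _ _)) hN₁
  have hNc : vD + a * (Cq + E₀) ≤ N ! :=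
    le_trans (le_trans (le_trans (le_max_right _ _) (le_max_right _ _)) hN₁) (Nat.self_le_factorial N)
  -- data of the level
  have hv0 : ((t.den : ℤ)) ≠ 0 := by exact_mod_cast t.den_nz
  have hcopr : IsCoprime t.num (t.den : ℤ) := isCoprime_num_den t
  have hqt : aeval t q ≠ 0 := hnr t
  obtain ⟨κ, w, hGκ, hκ0, hκle, hwQ, hQle, hCw, haw⟩ :=
    level_arith hq hnr hga hD ha hd hdiv hE₀ hDdec hD'odd hN2 hNc ht
  obtain ⟨-, -, -, -, hGQ⟩ := level_kappa hq hnr hga hD hN2 ht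
  obtain ⟨d₁, A, B, hd₁, hid, hA, hB⟩ := (hRes t.num t.den hv0).2
  have hQ0 : hform q.coeff 2 t.num t.den ≠ 0 := Qform_ne_zero hq hnr t
  have hH2 := level_height (g := g) (D := D) hq ha hCb hKa hK2 hd₁ hv0 hid hA hB hQ0 hGQ
  -- the exponent parameter `t' = ⌈w/2⌉`
  set t' : ℕ := (w + 1) / 2 with ht'
  have ht'1 : 2 * t' ≤ w + 1 := by omega
  have ht'2 : w ≤ 2 * t' := by omega
  have hwN : w ≤ N ! + E₀ := le_trans (by nlinarith : w ≤ a * w) haw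
  have hgap := factorial_gap_bound E₀ hNE
  have hM : 3 * t' ≤ 2 * (Nat.factorial N - Nat.factorial (N - 1)) := by omega
  set X : ℝ := ((1 / 2 : ℝ) ^ t') ^ (3 / 2 : ℝ) with hX
  have hXpos : 0 < X := by positivity
  have hεX : (1 / 2 : ℝ) ^ w ≤ 2 * X := half_pow_le_two_mul_rpow ht'1
  have hMX : (1 / 2 : ℝ) ^ (Nat.factorial N - Nat.factorial (N - 1)) ≤ X := half_pow_le_rpow_of_le hM
  -- HEIGHT: `max |u| |v| ≤ A₀ 2^{t'}`
  have hQR : |((hform q.coeff 2 t.num t.den : ℤ) : ℝ)| ≤ |(d : ℝ)| * 2 ^ w := by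
    have := hQle; rw [← Int.cast_abs, ← Int.cast_abs]; exact_mod_cast this
  have hHsq : (max |(t.num : ℝ)| |((t.den : ℤ) : ℝ)|) ^ 2 ≤ A₀ * ((2 : ℝ) ^ t') ^ 2 := by
    calc _ ≤ heightC q Cb K D * |((hform q.coeff 2 t.num t.den : ℤ) : ℝ)| := hH2
      _ ≤ heightC q Cb K D * (|(d : ℝ)| * 2 ^ w) := by gcongr
      _ = A₀ * 2 ^ w := by rw [hA₀]; ring
      _ ≤ A₀ * ((2 : ℝ) ^ t') ^ 2 := by
          rw [← pow_mul]; gcongr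
          · norm_num
          · omega
  have hHle : max |(t.num : ℝ)| |((t.den : ℤ) : ℝ)| ≤ A₀ * 2 ^ t' := by
    have := abs_le_of_sq_le hA₀1 (by positivity) hHsq
    rwa [abs_of_nonneg (le_trans (abs_nonneg _) (le_max_left _ _))] at this
  have hvle : |((t.den : ℤ) : ℝ)| ≤ A₀ * 2 ^ t' := le_trans (le_max_right _ _) hHle
  have hule : |((q.coeff 2 * t.num : ℤ) : ℝ)| ≤ (|(q.coeff 2 : ℝ)| * A₀) * 2 ^ t' := by
    push_cast
    rw [abs_mul, mul_assoc]
    gcongr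
    exact le_trans (le_max_left _ _) hHle
  -- 2-ADIC CLOSENESS
  obtain ⟨θ, hθ, hlin, hpow⟩ :=
    level_padic (g := g) (a := a) hsum hprod hne hθ₁1 hθ₂1 hCq hcopr hwQ hCw (by omega : 1 ≤ N) hGκ
  have hĝθ : hform (ghatc g q a) (2 * a) θ 1 ≠ 0 := by rcases hθ with rfl | rfl; exacts [hĝ₁, hĝ₂]
  have hγθ : γ ≤ ‖hform (ghatc g q a) (2 * a) θ 1‖ := by
    rcases hθ with rfl | rfl
    exacts [min_le_left _ _, min_le_right _ _]
  have hlinX : ‖(q.coeff 2 : PadicAlgCl 2) * t.num - θ * (t.den : ℤ)‖ ≤ (2 / δ) * X := by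
    calc _ ≤ (1 / 2 : ℝ) ^ w / δ := hlin
      _ ≤ (2 * X) / δ := by gcongr
      _ = (2 / δ) * X := by ring
  have hpowX : ‖((t.den : ℤ) : PadicAlgCl 2) ^ (2 * a) * hform (ghatc g q a) (2 * a) θ 1
      - (q.coeff 2 : PadicAlgCl 2) ^ (2 * a) * κ‖ ≤ (2 / δ + 1) * X := by
    calc _ ≤ (1 / 2 : ℝ) ^ w / δ + (1 / 2 : ℝ) ^ (Nat.factorial N - Nat.factorial (N - 1)) := hpow
      _ ≤ (2 * X) / δ + X := by gcongr
      _ = (2 / δ + 1) * X := by ring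
  have hlamX : ‖((t.den : ℤ) : PadicAlgCl 2) ^ (2 * a)
      - (q.coeff 2 : PadicAlgCl 2) ^ (2 * a) * κ / hform (ghatc g q a) (2 * a) θ 1‖ ≤ ((2 / δ + 1) / γ) * X := by
    have hn0 : 0 < ‖hform (ghatc g q a) (2 * a) θ 1‖ := norm_pos_iff.mpr hĝθ
    have : ((t.den : ℤ) : PadicAlgCl 2) ^ (2 * a)
        - (q.coeff 2 : PadicAlgCl 2) ^ (2 * a) * κ / hform (ghatc g q a) (2 * a) θ 1
        = (((t.den : ℤ) : PadicAlgCl 2) ^ (2 * a) * hform (ghatc g q a) (2 * a) θ 1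
            - (q.coeff 2 : PadicAlgCl 2) ^ (2 * a) * κ) / hform (ghatc g q a) (2 * a) θ 1 := by
      field_simp
    rw [this, norm_div, div_le_iff₀ hn0]
    calc _ ≤ (2 / δ + 1) * X := hpowX
      _ = ((2 / δ + 1) / γ) * X * γ := by field_simp
      _ ≤ ((2 / δ + 1) / γ) * X * ‖hform (ghatc g q a) (2 * a) θ 1‖ := by gcongr
  obtain ⟨ζ, hζT, hζ⟩ := hT (κ, θ) ⟨hκ0, hθ⟩ _ _ hlamX
  -- MEMBERSHIP: `den t ∈ V`
  have hθS : θ ∈ ({θ₁, θ₂} : Set (PadicAlgCl 2)) := by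
    rcases hθ with rfl | rfl <;> simp
  have hθF : θ ∈ ({θ₁, θ₂} : Finset (PadicAlgCl 2)) := by
    rcases hθ with rfl | rfl <;> simp
  have hvV : (t.den : ℤ) ∈ V := by
    rw [hV]
    refine Set.mem_biUnion (Set.mem_Icc.mpr (abs_le.mp hκle)) (Set.mem_biUnion hθS ?_)
    refine ⟨t', hvle, ζ, hζT, ?_⟩
    calc ‖((t.den : ℤ) : PadicAlgCl 2) - ((1 : ℤ) : PadicAlgCl 2) * ζ‖ = ‖((t.den : ℤ) : PadicAlgCl 2) - ζ‖ := by
          simp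
      _ ≤ C₁ (κ, θ) * (((2 / δ + 1) / γ) * X) := hζ
      _ = (C₁ (κ, θ) * ((2 / δ + 1) / γ)) * X := by ring
  -- MEMBERSHIP: `q₂ · num t ∈ U`
  have huU : q.coeff 2 * t.num ∈ U := by
    rw [hU]
    refine Set.mem_biUnion hvV ⟨t', hule, θ, hθF, ?_⟩
    calc ‖((q.coeff 2 * t.num : ℤ) : PadicAlgCl 2) - ((t.den : ℤ) : PadicAlgCl 2) * θ‖
        = ‖(q.coeff 2 : PadicAlgCl 2) * t.num - θ * (t.den : ℤ)‖ := by push_cast; ring_nf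
      _ ≤ (2 / δ) * X := hlinX
  -- CONCLUSION: `t ∈ Tpts`, `sQ N ∈ F`
  have htT : t ∈ Tpts := by
    rw [hTpts]
    refine ⟨((t.den : ℤ), q.coeff 2 * t.num), ⟨hvV, huU⟩, ?_⟩
    have hq2Q : (q.coeff 2 : ℚ) ≠ 0 := by exact_mod_cast hq2
    show (((q.coeff 2 * t.num : ℤ) : ℚ) / (q.coeff 2 : ℚ)) / ((t.den : ℤ) : ℚ) = t
    rw [Int.cast_mul, mul_comm, mul_div_assoc, div_self hq2Q, mul_one, Int.cast_natCast]
    exact Rat.num_div_den t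
  refine ⟨t, htT, ?_⟩
  have hDq : (D : ℚ) * (aeval t q) ^ a ≠ 0 := mul_ne_zero (by exact_mod_cast hD) (pow_ne_zero _ hqt)
  rw [div_eq_iff hDq, ht]
  ring

/-! ### §8.8 Corollaries: the two split grades, and LEVEL FINITENESS / `ThinFibre m₀` / (b) from `SiegelShapes` ALONE -/

/-- **The split-imaginary conjugate-poles grade — PROVED** (special case of `normShapeLF_holds`). -/
theorem normShapeLFSplitImag_holds : NormShapeLFSplitImag :=
  fun g q a D hH _ _ => normShapeLF_holds g q a D hH

/-- **The split-real conjugate-poles grade (g47's residual family `q = t² − 17`) — PROVED.** -/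
theorem normShapeLFSplitReal_holds : NormShapeLFSplitReal :=
  fun g q a D hH _ _ => normShapeLF_holds g q a D hH

/-- all three grades at once, hypothesis-free. -/
theorem normShapeLevels_finite (g q : ℤ[X]) (a : ℕ) (D : ℤ) (hH : NormShapeHyp g q a D) :
    (NormShapeLevels g q a D).Finite :=
  normShapeLF_holds g q a D hH

/-- **PRIME-LEVEL FINITENESS FROM SIEGEL'S THEOREM ALONE**: every exceptional shape of the Siegel–Mahler trichotomy
(one pole §3, two rational poles §5, two conjugate poles §7–§8) is now proved; the only binder left is `SiegelShapes`
(Siegel–Mahler–Lang, cite item wi-102309). -/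
theorem levelFinite_of_siegelShapes'' (hS : SiegelShapes) :
    ∀ P : ℤ[X][X], Prime P → 2 ≤ P.natDegree → LevelFinite P :=
  levelFinite_of_siegelShapes' hS normShapeLFSplitImag_holds normShapeLFSplitReal_holds

/-- **THE UNIFORM THIN-FIBRE RESIDUAL `ThinFibre m₀` FOR EVERY `m₀ ≥ 2`, FROM SIEGEL'S THEOREM ALONE.** -/
theorem thinFibre_of_siegelShapes'' (hS : SiegelShapes) {m₀ : ℕ} (hm : 2 ≤ m₀) : ThinFibre m₀ :=
  thinFibre_of_siegelShapes' hS normShapeLFSplitImag_holds normShapeLFSplitReal_holds hm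

/-- **THE (b)-CELL `AlgebraicIndependent ℚ ![ℓ₂, ρ]`, `ρ ∈ SkelFix m₀`, `m₀ ≥ 2`, FROM SIEGEL'S THEOREM ALONE.** -/
theorem b_of_siegelShapes'' (hS : SiegelShapes) {m₀ : ℕ} (hm : 2 ≤ m₀) (ρ : ℝ) (hρ : SkelLiouvilleFix m₀ ρ) :
    AlgebraicIndependent ℚ ![((liouvilleNumber 2 : ℝ) : ℂ), (ρ : ℂ)] :=
  b_of_siegelShapes' hS normShapeLFSplitImag_holds normShapeLFSplitReal_holds hm ρ hρ

/-- **ITEM 31077 ON `(ℓ₂, ρ)`, `ρ ∈ SkelFix m₀`, `m₀ ≥ 2`, FROM SIEGEL'S THEOREM ALONE** (binders VERBATIM + one cell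
line `Set.range z = Set.range ![ℓ₂, ρ]`). -/
theorem coordLiouvilleSchanuel_pair_of_siegelShapes'' (hS : SiegelShapes) {m₀ : ℕ} (hm : 2 ≤ m₀) {ρ : ℝ}
    (hρ : SkelLiouvilleFix m₀ ρ) :
    ∀ (n : ℕ) (z : Fin n → ℂ), LinearIndependent ℚ z →
      Set.range z = Set.range ![((liouvilleNumber 2 : ℝ) : ℂ), (ρ : ℂ)] →
      (∃ w ∈ Submodule.span ℚ (Set.range z), Liouville w.re ∨ Liouville w.im) →
      (n : Cardinal) ≤ Algebra.trdeg ℚ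
        ↥(IntermediateField.adjoin ℚ (Set.range z ∪ Set.range (Complex.exp ∘ z))) :=
  coordLiouvilleSchanuel_pair_of_shapes hS laurentShapeLF_holds normShapeLFNonsplit_holds
    normShapeLFSplitImag_holds normShapeLFSplitReal_holds hm hρ

/-! ### §8.9 Hypothesis-free instances: the conjugate-poles SHAPE CURVES themselves (incl. g47's residual family) -/

open Summit.Schanuel.Schanuel.Theorems.RootDecomp1KXLinear (bev_map_C)

/-- the curve of the conjugate-poles shape `x·D·q(y)^a = g(y)` as an element of `ℤ[x][Y]`. -/
noncomputable def normShapeCurve (g q : ℤ[X]) (a : ℕ) (D : ℤ) : ℤ[X][X] :=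
  C (C D * X) * (Polynomial.map (C : ℤ →+* ℤ[X]) q) ^ a - Polynomial.map (C : ℤ →+* ℤ[X]) g

/-- `(g q : ℤ[X]) (a : ℕ) (D : ℤ) (x y : ℝ) : bev (normShapeCurve g q a D) x y = D * x * (aeval y q) ^ a - aeval y g`. -/
theorem bev_normShapeCurve (g q : ℤ[X]) (a : ℕ) (D : ℤ) (x y : ℝ) :
    bev (normShapeCurve g q a D) x y = D * x * (aeval y q) ^ a - aeval y g := by
  rw [normShapeCurve, bev_sub, bev_mul, bev_pow, bev_map_C, bev_map_C, bev_C]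
  simp

/-- **LEVEL FINITENESS OF EVERY CONJUGATE-POLES SHAPE CURVE — hypothesis-free.** -/
theorem levelFinite_normShapeCurve {g q : ℤ[X]} {a : ℕ} {D : ℤ} (hH : NormShapeHyp g q a D) :
    LevelFinite (normShapeCurve g q a D) := by
  intro C
  refine (normShapeLF_holds g q a D hH).subset ?_
  rintro N ⟨r, -, hP, -⟩
  refine ⟨r, ?_⟩
  rw [bev_normShapeCurve, sub_eq_zero, ← sQ_cast, ← aeval_ratCast, ← aeval_ratCast] at hP
  have : ((aeval r g : ℚ) : ℝ) = ((D * sQ N * (aeval r q) ^ a : ℚ) : ℝ) := by push_cast; exact hP.symm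
  exact_mod_cast this

/-- … hence its thin-fibre clause at every quality `m₀`, hypothesis-free. -/
theorem thinFibreAt_normShapeCurve {g q : ℤ[X]} {a : ℕ} {D : ℤ} (hH : NormShapeHyp g q a D) (m₀ : ℕ) :
    ThinFibreAt m₀ (normShapeCurve g q a D) :=
  thinFibreAt_of_levelFinite (levelFinite_normShapeCurve hH) m₀

/-- **g47's residual family, the simplest member `x·(y² − 17) = 1` (`q = Y² − 17`: `2` split, `q` indefinite):
LEVEL FINITENESS, hypothesis-free.** -/
theorem levelFinite_sqrt17_curve : LevelFinite (normShapeCurve 1 (X ^ 2 - 17) 1 1) := by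
  refine levelFinite_normShapeCurve ⟨?_, ?_, ?_, le_rfl, by simp, one_ne_zero⟩
  · compute_degree!
  · intro t ht
    have e : aeval t (X ^ 2 - 17 : ℤ[X]) = t ^ 2 - 17 := by
      have h17 : (17 : ℤ[X]) = C 17 := rfl
      rw [h17, map_sub, map_pow, aeval_X, aeval_C]
      simp
    rw [e, sub_eq_zero] at ht
    have ht' : ((t : ℝ)) ^ 2 = 17 := by exact_mod_cast congrArg (fun x : ℚ => (x : ℝ)) ht
    have hirr : Irrational (Real.sqrt 17) := by
      simpa using Nat.Prime.irrational_sqrt (p := 17) (by norm_num)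
    have hs : Real.sqrt 17 = ((|t| : ℚ) : ℝ) := by
      rw [← ht', Real.sqrt_sq_eq_abs, Rat.cast_abs]
    exact hirr.ne_rat _ hs
  · intro z _
    simp

end SplitGrades

end Summit.Schanuel.Schanuel.Theorems.RootDecomp1KLevelFinite

end
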